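import Summits.CriticalPhenomena.PercolationContinuityZ3.Theorems.Transplant.SkelPhiStepIDataNS
import Summits.CriticalPhenomena.PercolationContinuityZ3.Theorems.Transplant.PlanarSkeletonFrmDefs
import Summits.CriticalPhenomena.PercolationContinuityZ3.Theorems.Transplant.SkelNeg1ChoiceO
import Summits.CriticalPhenomena.PercolationContinuityZ3.Theorems.Transplant.SkelPhiParamsSched
import HarnessLib

/-!
# N2 (frames-only node `SamePDropOfSkeletonFrm₁`, OPEN) — (ζ″) ledger VOCABULARY over `PlanarSkeletonFrm` ((R-20), p3-g14 2026-08-22T18:03:54Z):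
# the SLOT TYPES `Neg.FSlot/SSlot`, `NegB.PSlot/SSlot` over `Frm`/`DataNS`, and the Step-I‴ OUTPUT RECORD AS THE LEDGER READS IT, `Skelφ.StepI.OutNS`

builds on p205010 (kernel theorem, internal audit signed; external expert review pending) — nothing in this file uses p205010; NOTHING is claimed about
the open node `SamePDropOfSkeletonFrm₁` (`SamePDropOfSkeletonNeg₁` is CLOSED in the tree and untouched).  DEFINITIONS ONLY: no probability, no skeleton facts.
Lane `prim-bschramm-*`, seat `prim-bschramm-stmt` (gen 19); helper file (`--supports stmt-CriticalPhenomena-4575 --as helper`); ledger HOME/prim-bschramm-stmt/FRM-PARAMS.md §9, (R-14)/(R-20).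

WHY.  The 123 params files of the N1 column that sit above its choice layer read, from that layer, almost only VOCABULARY (census stmt-g19 18:01Z:
`Neg.FSlot` 96×/59 files, `NegB.PSlot/SSlot` 31×/9, `OutO`+`.merged/.D/.DT/.ori` 20×/11); with these twins in the tree they port mechanically (port_frm.py,
tool of record (R-14)) without waiting for the closure tops (`ChoiceFnNO‴`/`AtQOQ`, p3's WAVE 0 (c2)), which only ≈ 10 files genuinely need.
* `PlanarSkeletonFrm.Neg.FSlot`, `PlanarSkeletonFrm.Neg.SSlot` — N1's `Neg.FSlot/SSlot` (SkelNeg1ChoiceAll :99/:103) with `PlanarSkeletonNeg G ↦ PlanarSkeletonFrm G` and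
  `DataN V ↦ DataNS V` (a slot VALUE may read the record's selectors; shape (B′));
* `PlanarSkeletonFrm.NegB.PSlot`, `PSlot.empty`, `PlanarSkeletonFrm.NegB.SSlot` — N1's `NegB.PSlot/SSlot` (SkelNegBChoiceAll :49/:54/:57) likewise;
* `Skelφ.StepI.OutNS V` — the ORIENTED Step-I‴ output `(D, DT, ori, qd, qdT)` of `exists_stepI_frQ` (p334216) with BOTH records carried as `DataNS` (p3: the transposed
  record is read by the y′-devices through the same pair constructors, so it carries selectors too); `OutNS.merged` (abbrev, as N1's `OutO.merged`), `OutNS.toOutO`,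
  `OutNS.quad` (the served quadrant in the chosen orientation — what (R-2)'s normalisation and `ScaleSel`'s colour read), and the `rfl` bridges
  `merged_toDataN`, `toOutO_D/DT/ori`, `merged_sM/sN`, `quad_of_eq_true/false`.  The closure (p3, (c2)) builds `O⁺ := ⟨DataNS.ofSel D h, DataNS.ofSel DT h′, ori, qd, qdT⟩`;
  the oriented FACTS (`FactsNS`) live in p3's file, not here.
[cite: KozmaNitzan2024, §4 Theorem 6 (pp. 25–31): the order of constants] [cite: MartineauTassion2017, §3.2 Lemma 3.2, Lemma 3.5]
-/

noncomputable section

namespace Summit.CriticalPhenomena.PercolationContinuityZ3.Theorems.Transplant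

open Literature.Probability.Percolation Literature.Probability.LatticeModels SimpleGraph
open SkelConc (Consts)

/-! ## §1 The slot types over `Frm` / `DataNS` -/

namespace PlanarSkeletonFrm

namespace Neg

/-- **A width-slot over `Frm`**: the value of the clearance floor `f` of `Neg.nL` as a function of everything p-fixed (constants, skeleton, base vertex, density,
merged record WITH its selectors). Twin of N1's `PlanarSkeletonNeg.Neg.FSlot`. [this work] -/
def FSlot : Type 1 :=
  ∀ (κ : Consts) {V : Type} [DecidableEq V] [Countable V] {G : SimpleGraph V} [G.LocallyFinite], PlanarSkeletonFrm G → V → unitInterval → Skelφ.StepI.DataNS V → ℕ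

/-- **A schedule-input slot over `Frm`** (width clearance, running density): the q-level fibre block `SchedIn`. Twin of N1's `PlanarSkeletonNeg.Neg.SSlot`. [this work] -/
def SSlot : Type 1 :=
  ∀ (κ : Consts) {V : Type} [DecidableEq V] [Countable V] {G : SimpleGraph V} [G.LocallyFinite],
    PlanarSkeletonFrm G → V → unitInterval → Skelφ.StepI.DataNS V → ℕ → unitInterval → Skelφ.Prm.SchedIn

end Neg

namespace NegB

/-- **A pair slot over `Frm`**: a finite set of EXTRA admissible pairs `(M, n)` as a function of the p-fixed data, bundled with its admissibility (read off the
record's thresholds `M₀`, `n₁`). Twin of N1's `PlanarSkeletonNeg.NegB.PSlot`. [this work] -/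
def PSlot : Type 1 :=
  ∀ (κ : Consts) {V : Type} [DecidableEq V] [Countable V] {G : SimpleGraph V} [G.LocallyFinite], PlanarSkeletonFrm G → V → unitInterval →
    ∀ D : Skelφ.StepI.DataNS V, {S : Finset (ℕ × ℕ) // ∀ q ∈ S, D.M₀ ≤ q.1 ∧ D.n₁ q.1 ≤ q.2}

/-- The empty pair slot over `Frm`. [folklore] -/
def PSlot.empty : PSlot := fun _ _ _ _ _ _ _ _ _ _ => ⟨∅, fun _ h => absurd h (Finset.notMem_empty _)⟩

/-- **A schedule-input slot over `Frm`** (box slot, width slot, running density): the q-level fibre block `SchedIn`. Twin of N1's `PlanarSkeletonNeg.NegB.SSlot`. [this work] -/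
def SSlot : Type 1 :=
  ∀ (κ : Consts) {V : Type} [DecidableEq V] [Countable V] {G : SimpleGraph V} [G.LocallyFinite],
    PlanarSkeletonFrm G → V → unitInterval → Skelφ.StepI.DataNS V → ℕ → ℕ → unitInterval → Skelφ.Prm.SchedIn

end NegB

end PlanarSkeletonFrm

/-! ## §2 The Step-I‴ output record as the ledger reads it -/

namespace Skelφ.StepI

/-- **The oriented Step-I‴ output as the N2 ledger reads it** ((R-20) field list of record): the record of `φ` and the record of `trφ φ`, BOTH carrying the scale
selectors (`DataNS`), the orientation bit `ori` (`true` = `φ`), and the preferred quadrants `qd`/`qdT` of the two charts (the outputs of `exists_stepI_frQ`, p334216).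
[this work] -/
structure OutNS (V : Type) where
  /-- the record of the skeleton map `φ`, with selectors -/
  D : DataNS V
  /-- the record of the transposed map `trφ φ`, with selectors -/
  DT : DataNS V
  /-- the orientation chosen at `(t, M, n)` (`true` = `φ`) -/
  ori : V → ℕ → ℕ → Bool
  /-- the preferred quadrant of `φ`'s equilibrium at `(t, M, n)` -/
  qd : V → ℕ → ℕ → ℤˣ × ℤˣ
  /-- the preferred quadrant of `trφ φ`'s equilibrium at `(t, M, n)` -/
  qdT : V → ℕ → ℕ → ℤˣ × ℤˣ

variable {V : Type}

/-- **The merged record of the oriented output, WITH selectors**: `O.D.orient O.DT O.ori` (`DataNS.orient`; shared fields and selectors from `O.D`, equilibrium data of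
the orientation `ori` selects). Twin of N1's `OutO.merged`. [this work] -/
abbrev OutNS.merged (O : OutNS V) : DataNS V := O.D.orient O.DT.toDataN O.ori

/-- The underlying N1-shaped output `(D, DT, ori)` (selectors and quadrants forgotten). [this work] -/
def OutNS.toOutO (O : OutNS V) : OutO V := ⟨O.D.toDataN, O.DT.toDataN, O.ori⟩

/-- **The served quadrant in the chosen orientation** at `(t, M, n)`: `qd` if `ori`, else `qdT` — what (R-2)'s normalisation and `ScaleSel`'s colour read. [this work] -/
def OutNS.quad (O : OutNS V) (t : V) (M n : ℕ) : ℤˣ × ℤˣ := if O.ori t M n = true then O.qd t M n else O.qdT t M n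

/-- The merged record's underlying `DataN` is the N1-shaped merged record `O.D.orient O.DT O.ori` (= N1's `OutO.merged` of `O.toOutO`). [folklore] -/
@[simp] theorem OutNS.merged_toDataN (O : OutNS V) : O.merged.toDataN = O.D.toDataN.orient O.DT.toDataN O.ori := rfl

/-- `O.toOutO.D = O.D.toDataN`. [folklore] -/
@[simp] theorem OutNS.toOutO_D (O : OutNS V) : O.toOutO.D = O.D.toDataN := rfl

/-- `O.toOutO.DT = O.DT.toDataN`. [folklore] -/
@[simp] theorem OutNS.toOutO_DT (O : OutNS V) : O.toOutO.DT = O.DT.toDataN := rfl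

/-- `O.toOutO.ori = O.ori`. [folklore] -/
@[simp] theorem OutNS.toOutO_ori (O : OutNS V) : O.toOutO.ori = O.ori := rfl

/-- The merged record's selectors are `O.D`'s. [folklore] -/
@[simp] theorem OutNS.merged_sM (O : OutNS V) : O.merged.sM = O.D.sM := rfl

/-- The merged record's selectors are `O.D`'s. [folklore] -/
@[simp] theorem OutNS.merged_sN (O : OutNS V) : O.merged.sN = O.D.sN := rfl

/-- The served quadrant at an index where `φ` is chosen. [folklore] -/
theorem OutNS.quad_of_eq_true (O : OutNS V) {t : V} {M n : ℕ} (h : O.ori t M n = true) : O.quad t M n = O.qd t M n := by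
  unfold OutNS.quad; rw [if_pos h]

/-- The served quadrant at an index where `trφ φ` is chosen. [folklore] -/
theorem OutNS.quad_of_eq_false (O : OutNS V) {t : V} {M n : ℕ} (h : O.ori t M n = false) : O.quad t M n = O.qdT t M n := by
  unfold OutNS.quad; rw [if_neg (by rw [h]; exact Bool.false_ne_true)]

end Skelφ.StepI

end Summit.CriticalPhenomena.PercolationContinuityZ3.Theorems.Transplant

end
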